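import Summits.Ventures.CertifiedManyBodySolver.Rows.DopedTLCorrBundleWND
import HarnessLib

/-!
# Bundle-WN rows WITH A GENERIC EXTRA STATE PREMISE («EXT» editions: DOCC-BOX, T′-BOX, any declared reader `--ext` row): the claim-node SHAPE of a pinned-pair read
# whose reader carried ONE extra declared row on the state, as an arbitrary predicate `ext : InfVolFermionState 2 → Prop`, and its elimination into the plain thick box
# window row once `ext` is discharged on the ground-state class of the cell (cell `pub/hubbard-obs`, D-0154 (1)(C) COVERAGE Hg-1201; captain hubbard-cov-hg1201-plan-1 g3
# RULINGS 2026-08-28T12:53:16Z (A) DOCC-BOX `ω-docc ≤ hi` and (E) T′-BOX `|ω-diag-hop letter| ≤ B_T′`, «the lemma named in the node»)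

HONEST FRAMING: NOTHING IS ASSERTED HERE: a `def … : Prop` and solver-free edges; no `sorry`, no named fact, zero compute. Companion of
`Rows/DopedTLCorrBundleWN.lean` / `Rows/DopedTLCorrBundleWND.lean` (same seat, `hubbard-cov-hg1201-box-1`, `prover-hubbard-cov-hg1201-box-1-g0-0`); the DOCC edition `…WND` is the
case `ext ω := ω.meanEnergy (hubbardTTPrimeFermionInteraction 0 0 1) 1 ≤ dhi` (`…WND.toWNX` below).

* §A the SHAPE `SquareTTPrimeBundleOrbitLowerRowWNX U₁ U₂ s₁ s₂ flo cap ext F sl₁ sl₂ n₀ S Λ X` (`ext : InfVolFermionState 2 → Prop` = the reader's extra row read as a statement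
  about the limit state; the node's docstring NAMES the lemma that discharges it);
* §B edges: WN ⇒ WNX (any `ext`), WND ⇒ WNX (the docc predicate), monotonicity in `ext`;
* §C **WNX SHAPE + `ext` discharged on the thick cell ⇒ the THICK box window row** (same conclusion as `…WN.orbitLowerBoxRowW_thick`), so every closer is unchanged.

References: S. Boyd, L. Vandenberghe, *Convex Optimization* (2004) §5.9 [BoydVandenberghe2004]; J. Wang et al., PRX 14 (2024) 031006, §III [WangEtAl2024].
-/

noncomputable section
noncomputable section

namespace Summit.Ventures.CertifiedManyBodySolver

open Literature.MathematicalPhysics.QuantumLattice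
open Matrix HubbardWave0 Literature.Probability.LatticeModels ThermodynamicLimit Filter Topology
open Summit.Ventures.CertifiedManyBodySolver.Downfold (wnBundleValue)
open scoped BigOperators ComplexOrder

/-! ## §A  The bundle-WN row shape with a generic extra state premise -/

/-- §A **BUNDLE-WN ROW SHAPE WITH AN EXTRA STATE PREMISE** `SquareTTPrimeBundleOrbitLowerRowWNX U₁ U₂ s₁ s₂ flo cap ext F sl₁ sl₂ n₀ S Λ X`: as `SquareTTPrimeBundleOrbitLowerRowWN`,
with ONE extra premise `ext ω` on the torus-limit state (the reader's declared `--ext` row: a double-occupancy box, a per-letter box, …); conclusion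
`wnBundleValue F sl₁ sl₂ n₀ x ≤ |S|⁻¹ Σ_{γ ∈ S} Re ω_{γΛ}(Γ(d4Emb γ 0) X)`. [cite: BoydVandenberghe2004, §5.9] -/
def SquareTTPrimeBundleOrbitLowerRowWNX (U₁ U₂ s₁ s₂ : ℝ) (flo cap : ℝ → ℝ → ℝ) (ext : InfVolFermionState 2 → Prop) (F sl₁ sl₂ n₀ : ℚ)
    (S : Finset (DihedralGroup 4)) (Λ : Finset (Site 2)) (X : FermionOp Λ) : Prop :=
  ∀ U ∈ Set.Icc U₁ U₂, ∀ s ∈ Set.Icc s₁ s₂, ∀ x : ℝ, 0 ≤ x → x < 2 →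
    ∀ (ω : InfVolFermionState 2) (Ls : ℕ → ℕ) (ψ : ∀ L, Fock (Orb (FermionTorus 2 L))),
      Tendsto Ls atTop atTop →
      (∀ j, IsGroundStateInSector (hubbardTorusTT' (Ls j) 1 s U) (rectN x (Ls j)) 0 (ψ (Ls j))) →
      (∀ j, star (ψ (Ls j)) ⬝ᵥ ψ (Ls j) = 1) → ω.IsTorusLimitOf ψ Ls →
      flo U s ≤ energyDensityTT' 1 s U x → energyDensityTT' 1 s U x ≤ cap U s → ext ω →
      wnBundleValue F sl₁ sl₂ n₀ x ≤
        (S.card : ℝ)⁻¹ * ∑ g ∈ S, (ω.expect (d4ShiftSet g 0 Λ) (fermionEmbed (PolySite.d4Emb g 0 Λ) X)).re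

/-! ## §B  Solver-free edges -/

section Edges

variable {U₁ U₂ s₁ s₂ : ℝ} {flo cap : ℝ → ℝ → ℝ} {ext ext' : InfVolFermionState 2 → Prop} {dhi F sl₁ sl₂ n₀ : ℚ} {S : Finset (DihedralGroup 4)}
  {Λ : Finset (Site 2)} {X : FermionOp Λ}

/-- A plain bundle-WN row is a WNX row for EVERY extra premise. [folklore] -/
theorem SquareTTPrimeBundleOrbitLowerRowWN.toWNX (h : SquareTTPrimeBundleOrbitLowerRowWN U₁ U₂ s₁ s₂ flo cap F sl₁ sl₂ n₀ S Λ X)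
    (ext : InfVolFermionState 2 → Prop) :
    SquareTTPrimeBundleOrbitLowerRowWNX U₁ U₂ s₁ s₂ flo cap ext F sl₁ sl₂ n₀ S Λ X :=
  fun U hU s hs x hx0 hx2 ω Ls ψ hLs hψ hψ1 hω hl hu _ => h U hU s hs x hx0 hx2 ω Ls ψ hLs hψ hψ1 hω hl hu

/-- The DOCC edition is the WNX row with the docc predicate. [folklore] -/
theorem SquareTTPrimeBundleOrbitLowerRowWND.toWNX (h : SquareTTPrimeBundleOrbitLowerRowWND U₁ U₂ s₁ s₂ flo cap dhi F sl₁ sl₂ n₀ S Λ X) :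
    SquareTTPrimeBundleOrbitLowerRowWNX U₁ U₂ s₁ s₂ flo cap
      (fun ω => ω.meanEnergy (hubbardTTPrimeFermionInteraction 0 0 1) 1 ≤ ((dhi : ℚ) : ℝ)) F sl₁ sl₂ n₀ S Λ X :=
  fun U hU s hs x hx0 hx2 ω Ls ψ hLs hψ hψ1 hω hl hu hd => h U hU s hs x hx0 hx2 ω Ls ψ hLs hψ hψ1 hω hl hu hd

/-- Monotonicity in the premise: a WNX row for `ext` is one for every STRONGER premise `ext' ⇒ ext`. [folklore] -/
theorem SquareTTPrimeBundleOrbitLowerRowWNX.mono_ext (h : SquareTTPrimeBundleOrbitLowerRowWNX U₁ U₂ s₁ s₂ flo cap ext F sl₁ sl₂ n₀ S Λ X)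
    (himp : ∀ ω, ext' ω → ext ω) : SquareTTPrimeBundleOrbitLowerRowWNX U₁ U₂ s₁ s₂ flo cap ext' F sl₁ sl₂ n₀ S Λ X :=
  fun U hU s hs x hx0 hx2 ω Ls ψ hLs hψ hψ1 hω hl hu he => h U hU s hs x hx0 hx2 ω Ls ψ hLs hψ hψ1 hω hl hu (himp ω he)

end Edges

/-! ## §C  WNX SHAPE + the premise discharged on the thick cell ⇒ the THICK box window row -/

section Thick

variable {U₁ U₂ s₁ s₂ : ℝ} {flo cap : ℝ → ℝ → ℝ} {ext : InfVolFermionState 2 → Prop} {F sl₁ sl₂ n₀ : ℚ} {S : Finset (DihedralGroup 4)}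
  {Λ : Finset (Site 2)} {X : FermionOp Λ}

/-- **WNX SHAPE ⇒ THICK BOX WINDOW ROW, the extra premise DISCHARGED.** `0 ≤ n₁`, `n₂ < 2`; a rational slot `r` below the four end values; and `hext`: for every `(U, s)` of the
rectangle, every `x ∈ [n₁, n₂]` and every torus-limit sector ground state `ω` there obeying the cap row, `ext ω` (the lemma NAMED in the node — e.g. a GS docc ceiling, or a per-letter
kinematic bound true for every state). Then the plain `SquareTTPrimeCorrOrbitLowerBoxRowW …` on the thick cell. [cite: BoydVandenberghe2004, §5.9] [cite: WangEtAl2024, §III] -/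
theorem SquareTTPrimeBundleOrbitLowerRowWNX.orbitLowerBoxRowW_thick
    (h : SquareTTPrimeBundleOrbitLowerRowWNX U₁ U₂ s₁ s₂ flo cap ext F sl₁ sl₂ n₀ S Λ X) {n₁ n₂ : ℝ} (hn₁ : 0 ≤ n₁) (hn₂ : n₂ < 2)
    (hext : ∀ U ∈ Set.Icc U₁ U₂, ∀ s ∈ Set.Icc s₁ s₂, ∀ x ∈ Set.Icc n₁ n₂,
      ∀ (ω : InfVolFermionState 2) (Ls : ℕ → ℕ) (ψ : ∀ L, Fock (Orb (FermionTorus 2 L))),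
      Tendsto Ls atTop atTop →
      (∀ j, IsGroundStateInSector (hubbardTorusTT' (Ls j) 1 s U) (rectN x (Ls j)) 0 (ψ (Ls j))) →
      (∀ j, star (ψ (Ls j)) ⬝ᵥ ψ (Ls j) = 1) → ω.IsTorusLimitOf ψ Ls →
      energyDensityTT' 1 s U x ≤ cap U s → ext ω)
    {r : ℚ}
    (h₁₁ : ((r : ℚ) : ℝ) ≤ ((F : ℚ) : ℝ) + ((sl₁ : ℚ) : ℝ) * (n₁ - ((n₀ : ℚ) : ℝ)))
    (h₁₂ : ((r : ℚ) : ℝ) ≤ ((F : ℚ) : ℝ) + ((sl₁ : ℚ) : ℝ) * (n₂ - ((n₀ : ℚ) : ℝ)))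
    (h₂₁ : ((r : ℚ) : ℝ) ≤ ((F : ℚ) : ℝ) + ((sl₂ : ℚ) : ℝ) * (n₁ - ((n₀ : ℚ) : ℝ)))
    (h₂₂ : ((r : ℚ) : ℝ) ≤ ((F : ℚ) : ℝ) + ((sl₂ : ℚ) : ℝ) * (n₂ - ((n₀ : ℚ) : ℝ))) :
    SquareTTPrimeCorrOrbitLowerBoxRowW ![U₁, s₁, n₁] ![U₂, s₂, n₂] (fun θ => flo (θ 0) (θ 1)) (fun θ => cap (θ 0) (θ 1))
      r S Λ X := by
  intro θ hθ ω Ls ψ hLs hψ hψ1 hω hl hu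
  obtain ⟨⟨h0, h0'⟩, ⟨h1, h1'⟩, ⟨h2, h2'⟩⟩ := mem_thickCell_vec3 hθ
  have he := hext (θ 0) ⟨h0, h0'⟩ (θ 1) ⟨h1, h1'⟩ (θ 2) ⟨h2, h2'⟩ ω Ls ψ hLs hψ hψ1 hω hu
  have hrow := h (θ 0) ⟨h0, h0'⟩ (θ 1) ⟨h1, h1'⟩ (θ 2) (hn₁.trans h2) (lt_of_le_of_lt h2' hn₂) ω Ls ψ hLs hψ hψ1 hω hl hu he
  exact (le_wnBundleValue_of_ends h2 h2' h₁₁ h₁₂ h₂₁ h₂₂).trans hrow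

/-- **The same with RATIONAL density ends.** [cite: BoydVandenberghe2004, §5.9] -/
theorem SquareTTPrimeBundleOrbitLowerRowWNX.orbitLowerBoxRowW_thick_rat
    (h : SquareTTPrimeBundleOrbitLowerRowWNX U₁ U₂ s₁ s₂ flo cap ext F sl₁ sl₂ n₀ S Λ X) {n₁ n₂ : ℚ} (hn₁ : 0 ≤ n₁) (hn₂ : n₂ < 2)
    (hext : ∀ U ∈ Set.Icc U₁ U₂, ∀ s ∈ Set.Icc s₁ s₂, ∀ x ∈ Set.Icc ((n₁ : ℚ) : ℝ) ((n₂ : ℚ) : ℝ),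
      ∀ (ω : InfVolFermionState 2) (Ls : ℕ → ℕ) (ψ : ∀ L, Fock (Orb (FermionTorus 2 L))),
      Tendsto Ls atTop atTop →
      (∀ j, IsGroundStateInSector (hubbardTorusTT' (Ls j) 1 s U) (rectN x (Ls j)) 0 (ψ (Ls j))) →
      (∀ j, star (ψ (Ls j)) ⬝ᵥ ψ (Ls j) = 1) → ω.IsTorusLimitOf ψ Ls →
      energyDensityTT' 1 s U x ≤ cap U s → ext ω)
    {r : ℚ} (h₁₁ : r ≤ F + sl₁ * (n₁ - n₀)) (h₁₂ : r ≤ F + sl₁ * (n₂ - n₀)) (h₂₁ : r ≤ F + sl₂ * (n₁ - n₀))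
    (h₂₂ : r ≤ F + sl₂ * (n₂ - n₀)) :
    SquareTTPrimeCorrOrbitLowerBoxRowW ![U₁, s₁, ((n₁ : ℚ) : ℝ)] ![U₂, s₂, ((n₂ : ℚ) : ℝ)] (fun θ => flo (θ 0) (θ 1))
      (fun θ => cap (θ 0) (θ 1)) r S Λ X :=
  h.orbitLowerBoxRowW_thick (by exact_mod_cast hn₁) (by exact_mod_cast hn₂) hext (by exact_mod_cast h₁₁) (by exact_mod_cast h₁₂)
    (by exact_mod_cast h₂₁) (by exact_mod_cast h₂₂)

end Thick

end Summit.Ventures.CertifiedManyBodySolver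

end
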